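import Summits.HubbardSuperconductivity.HubbardSuperconductivity.Theorems.AnisotropyChordStiffnessFirstMoment

/-!
# Route `AnisotropyChord` / H0 rotor rung: bond-support counting for the double-commutator bound K1′
# (theory seat memo ROTOR-THEORY-8 §120/§121, work-order W5)

Directed bonds `b = (x, i)` of the `L × L` torus carry the two sites `bondSupp b = {x, x + eᵢ}`.  For a set of sites
`S`, `touch S` is the set of bonds meeting `S`; `#touch S ≤ 4·#S`.  The triple relation
`BondRel b' e b :≡ (supp e ∩ supp b ≠ ∅) ∧ (supp b' ∩ (supp e ∪ supp b) ≠ ∅)` — outside of which the double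
commutator `[j_{b'}ᴴ, [h_e, j_b]]` vanishes — has fibres of size `≤ 128` over each fixed `b` and over each fixed
`b'` (`card_relFibre_left_le`, `card_relFibre_right_le`), whence the weighted counting lemma
**`norm_triple_sum_le`**: `‖Σ_{b',e,b} conj(c_{b'}) c_b T(b',e,b)‖ ≤ 128·K·Σ_b |c_b|²` for any `T` bounded by `K`
and vanishing off the relation.
-/

set_option linter.dupNamespace false

noncomputable section

open Finset
open scoped ComplexConjugate
open Literature.MathematicalPhysics.QuantumLattice hiding torusPhase torusNorm
open Literature.Probability.LatticeModels

namespace Summit.HubbardSuperconductivity.HubbardSuperconductivity.Theorems.AnisotropyChord.Stiffness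

variable {L : ℕ} [NeZero L]

/-- The two sites of the directed bond `(x, i) ↦ {x, x + eᵢ}`. -/
def bondSupp (L : ℕ) (b : TorusSite 2 L × Fin 2) : Finset (TorusSite 2 L) :=
  {b.1, b.1 + Pi.single b.2 1}

/-- The bonds meeting a set of sites. -/
def touch (L : ℕ) [NeZero L] (S : Finset (TorusSite 2 L)) : Finset (TorusSite 2 L × Fin 2) :=
  Finset.univ.filter fun b => ¬ Disjoint (bondSupp L b) S

omit [NeZero L] in
/-- `#bondSupp b ≤ 2`. -/
theorem card_bondSupp_le (b : TorusSite 2 L × Fin 2) : (bondSupp L b).card ≤ 2 :=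
  Finset.card_le_two

/-- Membership in `touch`. -/
theorem mem_touch {S : Finset (TorusSite 2 L)} {b : TorusSite 2 L × Fin 2} :
    b ∈ touch L S ↔ ¬ Disjoint (bondSupp L b) S := by
  simp [touch]

/-- The bonds meeting `S` are among the four bonds at each site of `S`. -/
theorem touch_subset_biUnion (S : Finset (TorusSite 2 L)) :
    touch L S ⊆ S.biUnion fun z =>
      ({(z, 0), (z, 1), (z - Pi.single 0 1, 0), (z - Pi.single 1 1, 1)} : Finset (TorusSite 2 L × Fin 2)) := by
  intro b hb
  rw [mem_touch, Finset.not_disjoint_iff] at hb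
  obtain ⟨z, hzb, hzS⟩ := hb
  rw [Finset.mem_biUnion]
  refine ⟨z, hzS, ?_⟩
  obtain ⟨x, i⟩ := b
  simp only [bondSupp, Finset.mem_insert, Finset.mem_singleton] at hzb
  simp only [Finset.mem_insert, Finset.mem_singleton, Prod.mk.injEq]
  have fin2 : i = 0 ∨ i = 1 := by
    rcases Fin.eq_zero_or_eq_succ i with h | ⟨j, hj⟩
    · exact Or.inl h
    · right; rw [hj]; have := Fin.fin_one_eq_zero j; subst this; rfl
  rcases hzb with rfl | rfl <;> rcases fin2 with rfl | rfl <;> simp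

/-- **`#touch S ≤ 4·#S`.** -/
theorem card_touch_le (S : Finset (TorusSite 2 L)) : (touch L S).card ≤ 4 * S.card := by
  refine (Finset.card_le_card (touch_subset_biUnion S)).trans (Finset.card_biUnion_le.trans ?_)
  rw [mul_comm, ← smul_eq_mul, ← Finset.sum_const]
  exact Finset.sum_le_sum fun z _ => Finset.card_le_four

/-- The support relation outside of which `[j_{b'}ᴴ, [h_e, j_b]] = 0` (an `abbrev`, so that it is decidable
by unfolding). -/
abbrev BondRel (L : ℕ) (b' e b : TorusSite 2 L × Fin 2) : Prop :=
  ¬ Disjoint (bondSupp L e) (bondSupp L b) ∧ ¬ Disjoint (bondSupp L b') (bondSupp L e ∪ bondSupp L b)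

/-- Fibre of the relation over a fixed `b`: the pairs `(e, b')`. -/
theorem card_relFibre_right_le (b : TorusSite 2 L × Fin 2) :
    ((Finset.univ : Finset ((TorusSite 2 L × Fin 2) × (TorusSite 2 L × Fin 2))).filter
      fun p => BondRel L p.2 p.1 b).card ≤ 128 := by
  have hsub : ((Finset.univ : Finset ((TorusSite 2 L × Fin 2) × (TorusSite 2 L × Fin 2))).filter
      fun p => BondRel L p.2 p.1 b)
      ⊆ (touch L (bondSupp L b)).biUnion fun e =>
          (touch L (bondSupp L e ∪ bondSupp L b)).image fun b' => (e, b') := by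
    intro p hp
    simp only [Finset.mem_filter, Finset.mem_univ, true_and, BondRel] at hp
    rw [Finset.mem_biUnion]
    refine ⟨p.1, mem_touch.2 hp.1, ?_⟩
    rw [Finset.mem_image]
    exact ⟨p.2, mem_touch.2 hp.2, rfl⟩
  refine (Finset.card_le_card hsub).trans (Finset.card_biUnion_le.trans ?_)
  have h1 : ∀ e ∈ touch L (bondSupp L b),
      ((touch L (bondSupp L e ∪ bondSupp L b)).image fun b' => (e, b')).card ≤ 16 := by
    intro e _
    refine Finset.card_image_le.trans ((card_touch_le _).trans ?_)
    have := (Finset.card_union_le (bondSupp L e) (bondSupp L b)).trans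
      (add_le_add (card_bondSupp_le e) (card_bondSupp_le b))
    omega
  refine (Finset.sum_le_sum h1).trans ?_
  rw [Finset.sum_const, smul_eq_mul]
  have := (card_touch_le (bondSupp L b)).trans (Nat.mul_le_mul_left 4 (card_bondSupp_le b))
  omega

/-- Fibre of the relation over a fixed `b'`: the pairs `(e, b)`. -/
theorem card_relFibre_left_le (b' : TorusSite 2 L × Fin 2) :
    ((Finset.univ : Finset ((TorusSite 2 L × Fin 2) × (TorusSite 2 L × Fin 2))).filter
      fun p => BondRel L b' p.1 p.2).card ≤ 128 := by
  have hsub : ((Finset.univ : Finset ((TorusSite 2 L × Fin 2) × (TorusSite 2 L × Fin 2))).filter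
      fun p => BondRel L b' p.1 p.2)
      ⊆ ((touch L (bondSupp L b')).biUnion fun e => (touch L (bondSupp L e)).image fun b => (e, b))
        ∪ ((touch L (bondSupp L b')).biUnion fun b => (touch L (bondSupp L b)).image fun e => (e, b)) := by
    intro p hp
    simp only [Finset.mem_filter, Finset.mem_univ, true_and, BondRel] at hp
    obtain ⟨h1, h2⟩ := hp
    rw [Finset.disjoint_union_right, not_and_or] at h2
    rw [Finset.mem_union]
    rcases h2 with h2 | h2
    · left
      rw [Finset.mem_biUnion]
      refine ⟨p.1, mem_touch.2 fun h => h2 h.symm, ?_⟩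
      rw [Finset.mem_image]
      exact ⟨p.2, mem_touch.2 fun h => h1 h.symm, rfl⟩
    · right
      rw [Finset.mem_biUnion]
      refine ⟨p.2, mem_touch.2 fun h => h2 h.symm, ?_⟩
      rw [Finset.mem_image]
      exact ⟨p.1, mem_touch.2 h1, rfl⟩
  have h8 : ∀ b : TorusSite 2 L × Fin 2, (touch L (bondSupp L b)).card ≤ 8 := fun b =>
    (card_touch_le (bondSupp L b)).trans (by have := card_bondSupp_le b; omega)
  have hA : ((touch L (bondSupp L b')).biUnion fun e => (touch L (bondSupp L e)).image fun b => (e, b)).card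
      ≤ 64 := by
    refine Finset.card_biUnion_le.trans ?_
    refine (Finset.sum_le_sum fun e _ => Finset.card_image_le.trans (h8 e)).trans ?_
    rw [Finset.sum_const, smul_eq_mul]
    have := h8 b'
    omega
  have hB : ((touch L (bondSupp L b')).biUnion fun b => (touch L (bondSupp L b)).image fun e => (e, b)).card
      ≤ 64 := by
    refine Finset.card_biUnion_le.trans ?_
    refine (Finset.sum_le_sum fun b _ => Finset.card_image_le.trans (h8 b)).trans ?_
    rw [Finset.sum_const, smul_eq_mul]
    have := h8 b'
    omega
  exact (Finset.card_le_card hsub).trans ((Finset.card_union_le _ _).trans (by omega))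

/-- **Weighted support counting.** For a triple kernel `T` bounded by `K` and vanishing off `BondRel`,
`‖Σ_{b'} Σ_e Σ_b conj(c_{b'}) c_b T(b',e,b)‖ ≤ 128·K·Σ_b ‖c_b‖²`. -/
theorem norm_triple_sum_le (c : TorusSite 2 L × Fin 2 → ℂ)
    (T : (TorusSite 2 L × Fin 2) → (TorusSite 2 L × Fin 2) → (TorusSite 2 L × Fin 2) → ℂ) {K : ℝ} (hK : 0 ≤ K)
    (hT : ∀ b' e b, ‖T b' e b‖ ≤ K) (hT0 : ∀ b' e b, ¬ BondRel L b' e b → T b' e b = 0) :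
    ‖∑ b', ∑ e, ∑ b, starRingEnd ℂ (c b') * c b * T b' e b‖ ≤ 128 * K * ∑ b, ‖c b‖ ^ 2 := by
  -- indicator weight
  set g : (TorusSite 2 L × Fin 2) → (TorusSite 2 L × Fin 2) → (TorusSite 2 L × Fin 2) → ℝ :=
    fun b' e b => if BondRel L b' e b then K else 0 with hg
  have hTg : ∀ b' e b, ‖T b' e b‖ ≤ g b' e b := by
    intro b' e b
    simp only [hg]
    split_ifs with h
    · exact hT b' e b
    · rw [hT0 b' e b h, norm_zero]
  have hg0 : ∀ b' e b, 0 ≤ g b' e b := fun b' e b => by simp only [hg]; split_ifs <;> [exact hK; exact le_rfl]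
  -- fibre sums of the indicator
  have hleft : ∀ b', ∑ e, ∑ b, g b' e b ≤ 128 * K := by
    intro b'
    rw [← Finset.sum_product' (f := fun e b => g b' e b), hg]
    simp only
    rw [← Finset.sum_filter, Finset.sum_const, nsmul_eq_mul]
    exact mul_le_mul_of_nonneg_right (by exact_mod_cast card_relFibre_left_le b') hK
  have hright : ∀ b, ∑ b', ∑ e, g b' e b ≤ 128 * K := by
    intro b
    rw [Finset.sum_comm, ← Finset.sum_product' (f := fun e b' => g b' e b), hg]
    simp only
    rw [← Finset.sum_filter, Finset.sum_const, nsmul_eq_mul]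
    exact mul_le_mul_of_nonneg_right (by exact_mod_cast card_relFibre_right_le b) hK
  -- termwise: |conj(c') c T| ≤ (|c'|² + |c|²)/2 · g
  have hterm : ∀ b' e b, ‖starRingEnd ℂ (c b') * c b * T b' e b‖
      ≤ (‖c b'‖ ^ 2 / 2) * g b' e b + (‖c b‖ ^ 2 / 2) * g b' e b := by
    intro b' e b
    rw [norm_mul, norm_mul, Complex.norm_conj]
    have h1 := hTg b' e b
    have h2 : ‖c b'‖ * ‖c b‖ ≤ ‖c b'‖ ^ 2 / 2 + ‖c b‖ ^ 2 / 2 := by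
      nlinarith [sq_nonneg (‖c b'‖ - ‖c b‖), norm_nonneg (c b'), norm_nonneg (c b)]
    calc ‖c b'‖ * ‖c b‖ * ‖T b' e b‖ ≤ (‖c b'‖ ^ 2 / 2 + ‖c b‖ ^ 2 / 2) * g b' e b :=
          mul_le_mul h2 h1 (norm_nonneg _) (by positivity)
      _ = _ := by ring
  calc ‖∑ b', ∑ e, ∑ b, starRingEnd ℂ (c b') * c b * T b' e b‖
      ≤ ∑ b', ‖∑ e, ∑ b, starRingEnd ℂ (c b') * c b * T b' e b‖ := norm_sum_le _ _
    _ ≤ ∑ b', ∑ e, ‖∑ b, starRingEnd ℂ (c b') * c b * T b' e b‖ :=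
        Finset.sum_le_sum fun b' _ => norm_sum_le _ _
    _ ≤ ∑ b', ∑ e, ∑ b, ‖starRingEnd ℂ (c b') * c b * T b' e b‖ :=
        Finset.sum_le_sum fun b' _ => Finset.sum_le_sum fun e _ => norm_sum_le _ _
    _ ≤ ∑ b', ∑ e, ∑ b, ((‖c b'‖ ^ 2 / 2) * g b' e b + (‖c b‖ ^ 2 / 2) * g b' e b) :=
        Finset.sum_le_sum fun b' _ => Finset.sum_le_sum fun e _ => Finset.sum_le_sum fun b _ => hterm b' e b
    _ = ∑ b', (‖c b'‖ ^ 2 / 2) * ∑ e, ∑ b, g b' e b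
          + ∑ b, (‖c b‖ ^ 2 / 2) * ∑ b', ∑ e, g b' e b := by
        have e1 : ∑ b', ∑ e, ∑ b, (‖c b'‖ ^ 2 / 2) * g b' e b
            = ∑ b', (‖c b'‖ ^ 2 / 2) * ∑ e, ∑ b, g b' e b := by simp only [Finset.mul_sum]
        have e2 : ∑ b', ∑ e, ∑ b, (‖c b‖ ^ 2 / 2) * g b' e b
            = ∑ b, (‖c b‖ ^ 2 / 2) * ∑ b', ∑ e, g b' e b :=
          calc ∑ b', ∑ e, ∑ b, (‖c b‖ ^ 2 / 2) * g b' e b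
              = ∑ b', ∑ b, ∑ e, (‖c b‖ ^ 2 / 2) * g b' e b :=
                Finset.sum_congr rfl fun b' _ => Finset.sum_comm
            _ = ∑ b, ∑ b', ∑ e, (‖c b‖ ^ 2 / 2) * g b' e b := Finset.sum_comm
            _ = ∑ b, (‖c b‖ ^ 2 / 2) * ∑ b', ∑ e, g b' e b := by simp only [Finset.mul_sum]
        rw [← e1, ← e2]
        simp only [Finset.sum_add_distrib]
    _ ≤ ∑ b', (‖c b'‖ ^ 2 / 2) * (128 * K) + ∑ b, (‖c b‖ ^ 2 / 2) * (128 * K) := by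
        apply add_le_add
        · exact Finset.sum_le_sum fun b' _ => mul_le_mul_of_nonneg_left (hleft b') (by positivity)
        · exact Finset.sum_le_sum fun b _ => mul_le_mul_of_nonneg_left (hright b) (by positivity)
    _ = 128 * K * ∑ b, ‖c b‖ ^ 2 := by
        rw [← Finset.sum_mul, ← Finset.sum_div]
        ring

end Summit.HubbardSuperconductivity.HubbardSuperconductivity.Theorems.AnisotropyChord.Stiffness
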